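import Summits.Schanuel.Schanuel.Theorems.ZilberEacDoubleCancellingTools
import Summits.Schanuel.Schanuel.Theorems.ZilberEacDoubleCancellingEstimates
import HarnessLib

/-!
# The double-cancelling regime: depth of the two cancellations

Zilber's Exponential-Algebraic Closedness, case ladder (host summit Schanuel, cell `pub-schanuel`,
seat 2, gen 15).  Notation of `ZilberEacDoubleCancellingSystem` (HANDOFF O59 PLAN): label `n`,
sign `s = ±1`, branch `j₀`, `τ = Log(2πin/(r₀a₀s))`, `S = e^{τ/e₀}`, `ω = e^{2πi/e₀}`, base point
`P = Sω^{j₀}` (so `y₂ = e^{x₂} = Pe^{v/e₀}` for `x₂ = −2πisn + (τ + 2πij₀ + v)/e₀`), fibre sums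
`wⱼ(v) = Σ_{i<eⱼ} A_{j,i}P^{i+1}e^{(i+1)v/e₀}`.

* `exp_x₂_eq` — `e^{x₂} = Pe^{v/e₀}` and `e^{(i+1)x₂} = P^{i+1}e^{(i+1)v/e₀}`;
* **`re_w₁_ge`** (depth of the fibre-`1` cancellation) — under the PHASE HYPOTHESIS
  `κ‖a₁‖ ≤ Re(a₁U)`, `U = exp(e₁(i·arg(2πi/(r₀a₀s)) + 2πij₀)/e₀)`, for `‖v‖ ≤ min 1 (κ/8)` and
  `‖S‖ ≥ 1` large: `Re w₁(v) ≥ (κ/2)‖a₁‖‖S‖^{e₁} − 3(Σ_{i<e₁−1}‖A_{1,i}‖)‖S‖^{e₁−1}`;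
* **`re_w₀_ge`** (depth of the fibre-`0` cancellation near a clean solution) — if
  `x₂(V₀) + r₀w₀(V₀) + r₁w₁(V₀) = c` then `r₀ Re w₀(V₀) = Re c − Re x₂(V₀) − r₁ Re w₁(V₀)`, and
  `Re w₀` moves by at most `3(Σ‖A_{0,i}‖‖P‖^{i+1})‖v − V₀‖` on the unit ball.

HONEST FRAMING: estimates for explicit members of an OPEN cell (`ECCell 3 2`); NOT Schanuel's
conjecture; EAC ⇏ SC.
-/

noncomputable section

open Complex Filter Topology Metric Set

set_option linter.dupNamespace false

namespace Summit.Schanuel.Schanuel.Theorems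

section Depth

/-- `e^{−2πisn·m} = 1` for `s = ±1`, `n m : ℕ`. [folklore] -/
theorem exp_two_pi_I_sign_natCast {s : ℝ} (hs : s = 1 ∨ s = -1) (n m : ℕ) :
    exp (-(2 * Real.pi * I * (s : ℂ) * (n : ℂ)) * (m : ℂ)) = 1 := by
  rcases hs with h | h
  · rw [h, show -(2 * Real.pi * I * ((1 : ℝ) : ℂ) * (n : ℂ)) * (m : ℂ) =
      ((-(n * m : ℕ) : ℤ) : ℂ) * (2 * Real.pi * I) by push_cast; ring]
    exact Complex.exp_int_mul_two_pi_mul_I _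
  · rw [h, show -(2 * Real.pi * I * ((-1 : ℝ) : ℂ) * (n : ℂ)) * (m : ℂ) =
      (((n * m : ℕ)) : ℤ) * (2 * Real.pi * I) by push_cast; ring]
    exact Complex.exp_int_mul_two_pi_mul_I _

/-- **The base value along the ansatz**: `e^{(i+1)x₂} = P^{i+1}e^{(i+1)v/e₀}` with
`P = e^{τ/e₀}ω^{j₀}`, `x₂ = −2πisn + (τ + 2πij₀ + v)/e₀`. [folklore] -/
theorem exp_succ_mul_x₂_eq {s : ℝ} (hs : s = 1 ∨ s = -1) (n : ℕ) (e₀ : ℕ) (he₀ : 1 ≤ e₀)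
    (τ v : ℂ) (j₀ i : ℕ) :
    exp ((((i : ℕ) : ℂ) + 1) * (-(2 * Real.pi * I * (s : ℂ) * (n : ℂ)) +
        (τ + 2 * Real.pi * I * (j₀ : ℂ) + v) / (e₀ : ℂ))) =
      (exp (τ / (e₀ : ℂ)) * exp (2 * Real.pi * I / (e₀ : ℂ)) ^ j₀) ^ (i + 1) *
        exp ((((i : ℕ) : ℂ) + 1) * v / (e₀ : ℂ)) := by
  have heC : (e₀ : ℂ) ≠ 0 := by exact_mod_cast (show e₀ ≠ 0 by omega)
  rw [mul_add, Complex.exp_add, show (((i : ℕ) : ℂ) + 1) * -(2 * Real.pi * I * (s : ℂ) * (n : ℂ)) =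
    -(2 * Real.pi * I * (s : ℂ) * (n : ℂ)) * ((i + 1 : ℕ) : ℂ) by push_cast; ring,
    exp_two_pi_I_sign_natCast hs n (i + 1), one_mul, ← Complex.exp_nat_mul, mul_pow,
    ← Complex.exp_nat_mul, ← Complex.exp_nat_mul, ← Complex.exp_add, ← Complex.exp_add]
  congr 1
  push_cast
  field_simp

/-- **Depth of the fibre-`1` cancellation.**  With `P = e^{τ/e₀}ω^{j₀}`, `τ = Log(2πin/(r₀A))`,
the phase hypothesis `κ‖a₁‖ ≤ Re(a₁U)` (`U = exp(e₁(i arg(2πi/(r₀A)) + 2πij₀)/e₀)`), `‖v‖ ≤ δ ≤ 1`,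
`2δ ≤ κ/4`, `1 ≤ ‖S‖` (`S = e^{τ/e₀}`): `Re w₁(v) ≥ (κ − κ/4)‖a₁‖‖S‖^{e₁} − 3(Σ_{i<e₁−1}‖A_{1,i}‖)‖S‖^{e₁−1}`
where `w₁(v) = Σ_{i<e₁} A_{1,i}P^{i+1}e^{(i+1)v/e₀}`, `a₁ = A_{1,e₁−1}`. (new) -/
theorem re_w₁_ge (r₀ : ℝ) (A : ℂ) (e₀ e₁ : ℕ) (he₁ : 1 ≤ e₁)
    (he : e₁ ≤ e₀) (A₁ : ℕ → ℂ) (j₀ : ℕ) {κ δ : ℝ} (hδ1 : δ ≤ 1) (hδκ : 2 * δ ≤ κ / 4)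
    (hphase : κ * ‖A₁ (e₁ - 1)‖ ≤ (A₁ (e₁ - 1) * exp ((e₁ : ℂ) *
      (((Complex.arg (2 * Real.pi * I / ((r₀ : ℂ) * A)) : ℝ) : ℂ) * I + 2 * Real.pi * I * (j₀ : ℂ)) /
        (e₀ : ℂ))).re)
    {n : ℕ} (hn : 1 ≤ n)
    (hS : 1 ≤ ‖exp (Complex.log (2 * Real.pi * I * (n : ℂ) / ((r₀ : ℂ) * A)) / (e₀ : ℂ))‖)
    {v : ℂ} (hv : ‖v‖ ≤ δ) :
    (κ - κ / 4) * ‖A₁ (e₁ - 1)‖ *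
        ‖exp (Complex.log (2 * Real.pi * I * (n : ℂ) / ((r₀ : ℂ) * A)) / (e₀ : ℂ))‖ ^ e₁ -
      3 * (∑ i ∈ Finset.range (e₁ - 1), ‖A₁ i‖) *
        ‖exp (Complex.log (2 * Real.pi * I * (n : ℂ) / ((r₀ : ℂ) * A)) / (e₀ : ℂ))‖ ^ (e₁ - 1) ≤
    (∑ i ∈ Finset.range e₁, A₁ i *
      (exp (Complex.log (2 * Real.pi * I * (n : ℂ) / ((r₀ : ℂ) * A)) / (e₀ : ℂ)) *
        exp (2 * Real.pi * I / (e₀ : ℂ)) ^ j₀) ^ (i + 1) *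
      exp ((((i : ℕ) : ℂ) + 1) * v / (e₀ : ℂ))).re := by
  have he₀ : 1 ≤ e₀ := he₁.trans he
  have heC : (e₀ : ℂ) ≠ 0 := by exact_mod_cast (show e₀ ≠ 0 by omega)
  have hnpos : (0 : ℝ) < n := by exact_mod_cast hn
  set τ : ℂ := Complex.log (2 * Real.pi * I * (n : ℂ) / ((r₀ : ℂ) * A)) with hτ
  set S : ℂ := exp (τ / (e₀ : ℂ)) with hSdef
  set ω : ℂ := exp (2 * Real.pi * I / (e₀ : ℂ)) with hω
  set P : ℂ := S * ω ^ j₀ with hP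
  set B : ℕ → ℂ := fun i => A₁ i * P ^ (i + 1) with hB
  -- `‖ω‖ = 1`, `‖P‖ = ‖S‖`
  have hωn : ‖ω‖ = 1 := by
    rw [hω, Complex.norm_exp]
    simp [Complex.div_re, Complex.mul_re]
  have hPn : ‖P‖ = ‖S‖ := by rw [hP, norm_mul, norm_pow, hωn, one_pow, mul_one]
  -- apply the general estimate
  have hge := re_expSum_ge B (e₀ := e₀) he₁ he hδ1 hv
  have hsum : (∑ i ∈ Finset.range e₁, B i * exp ((((i : ℕ) : ℂ) + 1) * v / (e₀ : ℂ))) =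
      ∑ i ∈ Finset.range e₁, A₁ i * P ^ (i + 1) * exp ((((i : ℕ) : ℂ) + 1) * v / (e₀ : ℂ)) := by
    rfl
  rw [hsum] at hge
  -- the top coefficient: `B(e₁−1) = a₁ P^{e₁} = a₁ ‖S‖^{e₁} U`
  set U : ℂ := exp ((e₁ : ℂ) * ((((Complex.arg (2 * Real.pi * I / ((r₀ : ℂ) * A))) : ℝ) : ℂ) * I +
    2 * Real.pi * I * (j₀ : ℂ)) / (e₀ : ℂ)) with hU
  have harg : Complex.arg (2 * Real.pi * I * (n : ℂ) / ((r₀ : ℂ) * A)) =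
      Complex.arg (2 * Real.pi * I / ((r₀ : ℂ) * A)) := by
    rw [show 2 * Real.pi * I * (n : ℂ) / ((r₀ : ℂ) * A) =
      ((n : ℝ) : ℂ) * (2 * Real.pi * I / ((r₀ : ℂ) * A)) by push_cast; ring]
    exact Complex.arg_real_mul _ hnpos
  have hτsplit : τ = ((Real.log ‖2 * Real.pi * I * (n : ℂ) / ((r₀ : ℂ) * A)‖ : ℝ) : ℂ) +
      ((Complex.arg (2 * Real.pi * I / ((r₀ : ℂ) * A)) : ℝ) : ℂ) * I := by
    rw [hτ, ← harg]
    apply Complex.ext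
    · simp [Complex.log_re]
    · simp [Complex.log_im]
  have hPtop : P ^ e₁ = ((‖S‖ ^ e₁ : ℝ) : ℂ) * U := by
    have hSnorm : ((‖S‖ : ℝ) : ℂ) = exp (((Real.log ‖2 * Real.pi * I * (n : ℂ) / ((r₀ : ℂ) * A)‖ : ℝ) : ℂ) /
        (e₀ : ℂ)) := by
      rw [hSdef, Complex.norm_exp, Complex.ofReal_exp, Complex.div_natCast_re, hτ, Complex.log_re]
      push_cast
      rfl
    rw [hP, mul_pow, ← pow_mul, hU, Complex.ofReal_pow, hSnorm, hSdef, hω, ← Complex.exp_nat_mul,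
      ← Complex.exp_nat_mul, ← Complex.exp_nat_mul, ← Complex.exp_add, ← Complex.exp_add, hτsplit]
    congr 1
    push_cast
    field_simp
    ring
  have hBtop : B (e₁ - 1) = A₁ (e₁ - 1) * (((‖S‖ ^ e₁ : ℝ) : ℂ) * U) := by
    simp only [hB]
    rw [Nat.sub_add_cancel he₁, hPtop]
  have hBtop_norm : ‖B (e₁ - 1)‖ = ‖A₁ (e₁ - 1)‖ * ‖S‖ ^ e₁ := by
    simp only [hB]
    rw [norm_mul, norm_pow, Nat.sub_add_cancel he₁, hPn]
  have hBtop_re : κ * ‖A₁ (e₁ - 1)‖ * ‖S‖ ^ e₁ ≤ (B (e₁ - 1)).re := by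
    rw [hBtop, show A₁ (e₁ - 1) * (((‖S‖ ^ e₁ : ℝ) : ℂ) * U) =
      ((‖S‖ ^ e₁ : ℝ) : ℂ) * (A₁ (e₁ - 1) * U) by ring, Complex.re_ofReal_mul]
    have hpos : 0 ≤ ‖S‖ ^ e₁ := by positivity
    nlinarith [hphase]
  -- the lower coefficients
  have hlow : ∑ i ∈ Finset.range (e₁ - 1), ‖B i‖ ≤
      (∑ i ∈ Finset.range (e₁ - 1), ‖A₁ i‖) * ‖S‖ ^ (e₁ - 1) := by
    have : ∑ i ∈ Finset.range (e₁ - 1), ‖B i‖ = ∑ i ∈ Finset.range (e₁ - 1), ‖A₁ i‖ * ‖S‖ ^ (i + 1) := by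
      refine Finset.sum_congr rfl fun i _ => ?_
      simp only [hB]
      rw [norm_mul, norm_pow, hPn]
    rw [this]
    exact sum_norm_coeff_pow_le A₁ le_rfl hS
  -- assemble
  have h2δ : 2 * δ * ‖B (e₁ - 1)‖ ≤ κ / 4 * ‖A₁ (e₁ - 1)‖ * ‖S‖ ^ e₁ := by
    rw [hBtop_norm]
    have : 0 ≤ ‖A₁ (e₁ - 1)‖ * ‖S‖ ^ e₁ := by positivity
    nlinarith
  linarith [hge, hBtop_re, hlow, h2δ]

/-- **Depth of the fibre-`0` cancellation at a clean solution**: if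
`x₂ + r₀w₀ + r₁w₁ = c` then `r₀ Re w₀ = Re c − Re x₂ − r₁ Re w₁`. [folklore] -/
theorem re_w₀_eq_of_clean {r₀ r₁ : ℝ} {x₂ w₀ w₁ c : ℂ}
    (h : x₂ + (r₀ : ℂ) * w₀ + (r₁ : ℂ) * w₁ = c) :
    r₀ * w₀.re = c.re - x₂.re - r₁ * w₁.re := by
  have := congrArg Complex.re h
  simp only [Complex.add_re, Complex.re_ofReal_mul] at this
  linarith

/-- **Variation of a fibre sum on the unit ball**: `‖w(v) − w(v′)‖ ≤ 3(Σ‖Bᵢ‖)‖v − v′‖` for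
`‖v‖, ‖v′‖ ≤ 1` (mean value inequality with `norm_deriv_expSum_le`), hence
`Re w(v) ≥ Re w(v′) − 3(Σ‖Bᵢ‖)‖v − v′‖`. [folklore] -/
theorem re_expSum_ge_of_near (B : ℕ → ℂ) {e e₀ : ℕ} (he : e ≤ e₀) (he₀ : 1 ≤ e₀) {v v' : ℂ}
    (hv : ‖v‖ ≤ 1) (hv' : ‖v'‖ ≤ 1) :
    (∑ i ∈ Finset.range e, B i * exp ((((i : ℕ) : ℂ) + 1) * v' / (e₀ : ℂ))).re -
        3 * (∑ i ∈ Finset.range e, ‖B i‖) * ‖v - v'‖ ≤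
      (∑ i ∈ Finset.range e, B i * exp ((((i : ℕ) : ℂ) + 1) * v / (e₀ : ℂ))).re := by
  set W : ℂ → ℂ := fun v => ∑ i ∈ Finset.range e, B i * exp ((((i : ℕ) : ℂ) + 1) * v / (e₀ : ℂ))
    with hW
  have hdiff : ‖W v - W v'‖ ≤ 3 * (∑ i ∈ Finset.range e, ‖B i‖) * ‖v - v'‖ := by
    have hconv : Convex ℝ (closedBall (0 : ℂ) 1) := convex_closedBall _ _
    have hder : ∀ u ∈ closedBall (0 : ℂ) 1, HasDerivWithinAt W
        (∑ i ∈ Finset.range e, B i * (((((i : ℕ) : ℂ) + 1) / (e₀ : ℂ)) *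
          exp ((((i : ℕ) : ℂ) + 1) * u / (e₀ : ℂ)))) (closedBall (0 : ℂ) 1) u :=
      fun u _ => (hasDerivAt_expSum B e e₀ u).hasDerivWithinAt
    have hbd : ∀ u ∈ closedBall (0 : ℂ) 1, ‖∑ i ∈ Finset.range e, B i * (((((i : ℕ) : ℂ) + 1) / (e₀ : ℂ)) *
        exp ((((i : ℕ) : ℂ) + 1) * u / (e₀ : ℂ)))‖ ≤ 3 * ∑ i ∈ Finset.range e, ‖B i‖ := by
      intro u hu
      rw [mem_closedBall, dist_zero_right] at hu
      exact norm_deriv_expSum_le B he he₀ hu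
    have := hconv.norm_image_sub_le_of_norm_hasDerivWithin_le hder hbd
      (by rw [mem_closedBall, dist_zero_right]; exact hv')
      (by rw [mem_closedBall, dist_zero_right]; exact hv)
    simpa [hW] using this
  have hre : |(W v - W v').re| ≤ ‖W v - W v'‖ := Complex.abs_re_le_norm _
  rw [Complex.sub_re] at hre
  have := (abs_le.1 (hre.trans hdiff)).1
  simp only [hW] at this ⊢
  linarith

end Depth

end Summit.Schanuel.Schanuel.Theorems

end
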